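import Summits.BirchSwinnertonDyer.BirchSwinnertonDyer.Theorems.PrintCFramBottomClassIndexLawFiveLeCuspSeedQExpansionPrincipleAtZero
import Summits.BirchSwinnertonDyer.BirchSwinnertonDyer.Theorems.PrintCFramBottomClassIndexLawFiveLeCohenCutCarlitz
import Summits.BirchSwinnertonDyer.BirchSwinnertonDyer.Theorems.PrintCFramBottomClassIndexLawFiveLeFlipRungOfRung
import HarnessLib

/-!
# Crux `PrintCFram.BottomClassIndexLawFiveLe` (stmt-BirchSwinnertonDyer-20372), line `eisenstein-resource-bdp-line` (registry v27):
# THE FLIPPED-CUSP RUNG, piece T5 layer B/2 — the deconvolution through a `D`-supported theta factor and the `p`-adic readings of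
# «coefficient ∈ p·ℤ̄[1/N]»
# (cell `bsd-print-cfram`, width seat `bsd-line-cfram-p1-w8` g9; THEOREMS ONLY, `--supports` 20372; BSD is not proved by any of this)

HONEST FRAMING. Nothing here is a statement about BSD; no registered stub is closed. The modular side of the flipped-cusp rung (T1–T4,
vehicle (G)) reads the away-from-`q` cut of Cohen's `H_k` times `θ(q²Q₀²z)` at the cusp `ω₀(∞)` and returns, coefficient by coefficient,
«`(1 − q*)·c₀(qu) ∈ p·ℤ̄[1/N]`» on one Legendre class at `q`, where `c₀ = (away-cut Cohen numbers) ⋆ (theta coefficients)` and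
membership is NF-Q's `∃ y, (∃ j, IsIntegral ℤ (N^j·y)) ∧ x = p·y`. This file converts between that currency and (Rung⁶)'s
`‖H(k, a)‖_p ≤ p⁻¹` (modular-form-free):

* §2 DECONVOLUTION. `A` a power series over a commutative ring, `Θ : PowerSeries ℕ` with `coeff 0 Θ = 1` supported on multiples of `D`,
  `S` an additive subgroup, `P` a `D`-periodic index predicate: `coeff n (A·Θ) ∈ S` for all `n ∈ P` IFF `coeff n A ∈ S` for all `n ∈ P`
  (`forall_coeff_mem_of_mul_mem_of_periodic` / `forall_coeff_mul_mem_of_periodic`; triangular induction, nothing assumed about `A` off `P`;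
  `coeff_mul_map_eq_add_sum` splits off the diagonal term).
* §3 `p`-ADIC READINGS. `exists_addSubgroup_padicNorm_le` — `{x ∈ ℚ : ‖x‖_p ≤ p⁻¹}` as an `AddSubgroup ℚ` (the `S` of §2); OUTPUT side
  `padicNorm_le_inv_of_mul_unit_eq_prime_mul` — `(x·w : ℂ) = p·y`, `y ∈ ℤ̄[1/N]`, `p ∤ N`, `w` a rational `p`-unit ⟹ `‖x‖_p ≤ p⁻¹` (on w8 g8's
  (γ) `CuspGlue.le_padicValRat_of_eq_pow_mul`); INPUT side `exists_eq_prime_mul_isIntegral_of_padicNorm_le` — `‖x‖_p ≤ p⁻¹`, `2^j·x ∈ ℤ`,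
  `2 ∣ N` ⟹ `x ∈ p·ℤ̄[1/N]` (on w7 g6's (INT) `CohenCut.exists_eq_prime_mul_of_norm_lt_one`); and CARLITZ on a `±1`-pattern cut,
  `exists_two_pow_mul_cohenH_eq_intCast_of_cut_sign` — `2^j·H(k, a) ∈ ℤ` at every index of a `τ`-cut (`m ≠ 1`), keyed on the coprimality
  `gcd(m, n₀) = 1` of layer A's `coprime_of_cut_sign`.

No definitions, no named facts, no `sorry`. beyond-print theorem: NO (bookkeeping). References: crux notes lead-g14 §2.1;
[Carlitz1959]; [Katz1973] Cor. 1.6.2 (currency only).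
-/

set_option autoImplicit false
-- summit-side namespace `Summit.BirchSwinnertonDyer.BirchSwinnertonDyer.…` (single-conjunct summit, D-0017 layout)
set_option linter.dupNamespace false

noncomputable section

open scoped Classical NumberTheorySymbols
open PowerSeries

namespace Summit.BirchSwinnertonDyer.BirchSwinnertonDyer.Theorems.PrintCFram.FlipRung

open Summit.BirchSwinnertonDyer.BirchSwinnertonDyer.Theorems.PrintCFram

/-! ## §2 Deconvolution through a `D`-supported theta factor -/

/-- Cauchy product with the theta factor, split off the diagonal term: for `Θ : PowerSeries ℕ` with `coeff 0 Θ = 1`,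
`coeff n (A · Θ) = coeff n A + Σ_{i < n} coeff i A · Θ(n − i)`. [folklore] -/
theorem coeff_mul_map_eq_add_sum {R : Type*} [CommRing R] (A : PowerSeries R) (Θ : PowerSeries ℕ) (hΘ0 : coeff 0 Θ = 1) (n : ℕ) :
    coeff n (A * PowerSeries.map (Nat.castRingHom R) Θ) =
      coeff n A + ∑ i ∈ Finset.range n, coeff i A * ((coeff (n - i) Θ : ℕ) : R) := by
  rw [PowerSeries.coeff_mul, Finset.Nat.sum_antidiagonal_eq_sum_range_succ
    (fun i j => coeff i A * coeff j (PowerSeries.map (Nat.castRingHom R) Θ)), Finset.sum_range_succ, Nat.sub_self]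
  simp only [PowerSeries.coeff_map, hΘ0, map_one, mul_one, eq_natCast]
  rw [add_comm]

/-- **DECONVOLUTION (⇒).** `A` a power series over a commutative ring, `Θ : PowerSeries ℕ` with `coeff 0 Θ = 1` supported on multiples of
`D`, `S` an additive subgroup, `P` a `D`-periodic index predicate. If `coeff n (A·Θ) ∈ S` for every `n ∈ P` then `coeff n A ∈ S` for every
`n ∈ P` (triangular induction: the other terms of the Cauchy product have indices `n − jD ∈ P`). No hypothesis on `A` off `P`. [folklore] -/
theorem forall_coeff_mem_of_mul_mem_of_periodic {R : Type*} [CommRing R] (S : AddSubgroup R) (A : PowerSeries R)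
    (Θ : PowerSeries ℕ) {D : ℕ} (hΘ0 : coeff 0 Θ = 1) (hΘ : ∀ j : ℕ, coeff j Θ ≠ 0 → D ∣ j) {P : ℕ → Prop}
    (hP : Function.Periodic P D) (h : ∀ n : ℕ, P n → coeff n (A * PowerSeries.map (Nat.castRingHom R) Θ) ∈ S) :
    ∀ n : ℕ, P n → coeff n A ∈ S := by
  intro n
  induction n using Nat.strong_induction_on with
  | _ n ih =>
    intro hPn
    have key := coeff_mul_map_eq_add_sum A Θ hΘ0 n
    have hsum : ∑ i ∈ Finset.range n, coeff i A * ((coeff (n - i) Θ : ℕ) : R) ∈ S := by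
      refine S.sum_mem fun i hi => ?_
      rw [Finset.mem_range] at hi
      by_cases h0 : coeff (n - i) Θ = 0
      · rw [h0, Nat.cast_zero, mul_zero]; exact S.zero_mem
      · obtain ⟨t, ht⟩ := hΘ _ h0
        have hPi : P i := by
          have e : n = i + t * D := by rw [mul_comm]; omega
          rw [e] at hPn
          have hper := hP.nat_mul t i
          simp only [Nat.cast_id] at hper
          rwa [hper] at hPn
        have hi' := ih i hi hPi
        rw [mul_comm, ← nsmul_eq_mul]
        exact S.nsmul_mem hi' _
    have e : coeff n A = coeff n (A * PowerSeries.map (Nat.castRingHom R) Θ) -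
        ∑ i ∈ Finset.range n, coeff i A * ((coeff (n - i) Θ : ℕ) : R) := by rw [key]; ring
    rw [e]
    exact S.sub_mem (h n hPn) hsum

/-- **DECONVOLUTION (⇐).** Conversely, if `coeff n A ∈ S` for every `n ∈ P` then `coeff n (A·Θ) ∈ S` for every `n ∈ P`. [folklore] -/
theorem forall_coeff_mul_mem_of_periodic {R : Type*} [CommRing R] (S : AddSubgroup R) (A : PowerSeries R)
    (Θ : PowerSeries ℕ) {D : ℕ} (hΘ0 : coeff 0 Θ = 1) (hΘ : ∀ j : ℕ, coeff j Θ ≠ 0 → D ∣ j) {P : ℕ → Prop}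
    (hP : Function.Periodic P D) (h : ∀ n : ℕ, P n → coeff n A ∈ S) :
    ∀ n : ℕ, P n → coeff n (A * PowerSeries.map (Nat.castRingHom R) Θ) ∈ S := by
  intro n hPn
  rw [coeff_mul_map_eq_add_sum A Θ hΘ0 n]
  refine S.add_mem (h n hPn) (S.sum_mem fun i hi => ?_)
  rw [Finset.mem_range] at hi
  by_cases h0 : coeff (n - i) Θ = 0
  · rw [h0, Nat.cast_zero, mul_zero]; exact S.zero_mem
  · obtain ⟨t, ht⟩ := hΘ _ h0
    have hPi : P i := by
      have e : n = i + t * D := by rw [mul_comm]; omega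
      rw [e] at hPn
      have hper := hP.nat_mul t i
      simp only [Nat.cast_id] at hper
      rwa [hper] at hPn
    rw [mul_comm, ← nsmul_eq_mul]
    exact S.nsmul_mem (h i hPi) _

/-! ## §3 The `p`-adic readings -/

/-- **The subgroup `{x ∈ ℚ : ‖x‖_p ≤ p⁻¹}`** (ultrametric inequality), as an `AddSubgroup ℚ` — the `S` of §2 for the rung. [folklore] -/
theorem exists_addSubgroup_padicNorm_le (p : ℕ) [Fact p.Prime] :
    ∃ S : AddSubgroup ℚ, ∀ x : ℚ, x ∈ S ↔ ‖(x : ℚ_[p])‖ ≤ (p : ℝ)⁻¹ := by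
  refine ⟨{ carrier := {x : ℚ | ‖(x : ℚ_[p])‖ ≤ (p : ℝ)⁻¹}
            add_mem' := fun {a b} ha hb => ?_
            zero_mem' := by simp
            neg_mem' := fun {a} ha => by simpa using ha }, fun x => Iff.rfl⟩
  simp only [Set.mem_setOf_eq, Rat.cast_add] at ha hb ⊢
  exact (Padic.nonarchimedean _ _).trans (max_le ha hb)

/-- **OUTPUT reading.** `p ∤ N`, `x w : ℚ` with `w` a non-zero `p`-unit, and `(x·w : ℂ) = p·y` with `y ∈ ℤ̄[1/N]` ⟹ `‖x‖_p ≤ p⁻¹`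
(w8 g8's integrality transfer `CuspGlue.le_padicValRat_of_eq_pow_mul` at `e = 1`, read as a norm bound). [folklore] -/
theorem padicNorm_le_inv_of_mul_unit_eq_prime_mul {p N : ℕ} [hp : Fact p.Prime] (hpN : ¬ p ∣ N) {x w : ℚ} (hw0 : w ≠ 0)
    (hw : padicValRat p w = 0) {y : ℂ} (hy : ∃ j : ℕ, IsIntegral ℤ ((N : ℂ) ^ j * y))
    (h : (((x * w : ℚ)) : ℂ) = (p : ℂ) * y) : ‖(x : ℚ_[p])‖ ≤ (p : ℝ)⁻¹ := by
  have hp1 : (1 : ℝ) ≤ p := by exact_mod_cast hp.out.one_lt.le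
  rcases CuspGlue.le_padicValRat_of_eq_pow_mul hpN hy (e := 1) (by rw [pow_one]; exact h) with h0 | h1
  · have hx : x = 0 := (mul_eq_zero.mp h0).resolve_right hw0
    rw [hx, Rat.cast_zero, norm_zero]
    positivity
  · have hx0 : x ≠ 0 := by
      rintro rfl
      rw [zero_mul, padicValRat.zero] at h1
      norm_num at h1
    rw [padicValRat.mul hx0 hw0, hw, add_zero] at h1
    rw [Padic.eq_padicNorm, padicNorm.eq_zpow_of_nonzero hx0]
    push_cast
    calc ((p : ℝ)) ^ (-padicValRat p x) ≤ (p : ℝ) ^ (-1 : ℤ) :=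
          zpow_le_zpow_right₀ hp1 (by push_cast at h1; linarith)
      _ = (p : ℝ)⁻¹ := zpow_neg_one _

/-- **INPUT reading.** `x : ℚ` with `‖x‖_p ≤ p⁻¹` and `2^j·x ∈ ℤ`, `2 ∣ N` ⟹ `x ∈ p·ℤ̄[1/N]` in NF-Q's currency
`∃ y : ℂ, (∃ j, IsIntegral ℤ (N^j·y)) ∧ (x : ℂ) = p·y`. [folklore] -/
theorem exists_eq_prime_mul_isIntegral_of_padicNorm_le {p N : ℕ} [hp : Fact p.Prime] (h2N : 2 ∣ N) {x : ℚ}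
    (hx : ‖(x : ℚ_[p])‖ ≤ (p : ℝ)⁻¹) (h2 : ∃ (j : ℕ) (z : ℤ), (2 : ℚ) ^ j * x = z) :
    ∃ y : ℂ, (∃ j : ℕ, IsIntegral ℤ ((N : ℂ) ^ j * y)) ∧ ((x : ℚ) : ℂ) = (p : ℂ) * y := by
  have hp1 : (1 : ℝ) < p := by exact_mod_cast hp.out.one_lt
  have hlt : ‖(x : ℚ_[p])‖ < 1 := hx.trans_lt (inv_lt_one_of_one_lt₀ hp1)
  have hden : ∀ ℓ : ℕ, ℓ.Prime → ℓ ∣ x.den → ℓ = 2 := by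
    obtain ⟨j, z, hz⟩ := h2
    refine fun ℓ hℓ hdvd => CohenCut.eq_two_of_dvd_den_of_forall_norm_le_one (fun ℓ _ hℓ2 => ?_) hℓ hdvd
    -- `‖x‖_ℓ = ‖2^j x‖_ℓ = ‖z‖_ℓ ≤ 1` at an odd prime `ℓ`
    have h2u : ‖((2 : ℤ) : ℚ_[ℓ])‖ = 1 := by
      refine le_antisymm (Padic.norm_int_le_one _) (not_lt.mp fun hlt => hℓ2 ?_)
      have hd : (ℓ : ℤ) ∣ 2 := Padic.norm_intCast_lt_one_iff.mp hlt
      have hd' : ℓ ∣ 2 := by exact_mod_cast hd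
      exact (Nat.prime_dvd_prime_iff_eq (Fact.out) Nat.prime_two).mp hd'
    have hzx : ((z : ℚ) : ℚ_[ℓ]) = ((2 : ℤ) : ℚ_[ℓ]) ^ j * (x : ℚ_[ℓ]) := by
      rw [← hz]; push_cast; ring
    have hnz : ‖((z : ℚ) : ℚ_[ℓ])‖ ≤ 1 := by rw [Rat.cast_intCast]; exact Padic.norm_int_le_one _
    rw [hzx, norm_mul, norm_pow, h2u, one_pow, one_mul] at hnz
    exact hnz
  obtain ⟨y, hy, j', z', hz'⟩ := CohenCut.exists_eq_prime_mul_of_norm_lt_one (p := p) hlt hden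
  refine ⟨(y : ℂ), CohenCut.exists_isIntegral_pow_mul_of_two_pow_mul hz' h2N, ?_⟩
  rw [hy]; push_cast; ring

/-- **CARLITZ ON A `±1`-PATTERN CUT: `2^j · H(k, a) ∈ ℤ`** at every index `a` of a `τ`-cut (`m ∣ a`, `a/m ≡ 3 (mod 4)`, `J(−a/m | q') =
τ(q') = ±1` at the odd primes `q' ∣ m`), for a class character `χ` primitive quadratic modulo `m ≠ 1` with the parity clause and `k ≥ 1`
(w7 g6's (INT) lane `CohenCut.norm_lValueDisc_cut_le_one_of_odd_prime`, keyed on the coprimality `gcd(m, n₀) = 1` only) — the input-side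
hypothesis `h2` of `exists_eq_prime_mul_isIntegral_of_padicNorm_le`.
[cite: Carlitz1959, Theorem (integrality of k⁻¹B_{k,χ} for conductor with two distinct prime factors)] [cite: Cohen1975, §2 (definition of H(r, N))] -/
theorem exists_two_pow_mul_cohenH_eq_intCast_of_cut_sign {p : ℕ} [Fact p.Prime] {m : ℕ} [NeZero m]
    {χ : DirichletCharacter ℚ_[p] m} {k : ℕ} (hm1 : m ≠ 1) (hχ : χ.IsPrimitive) (hχq : χ.IsQuadratic) (hk : 1 ≤ k)
    (hpar : χ (-1) * (-1) ^ k = -1) {τ : ℕ → ℤ} (hτ : ∀ q : ℕ, q.Prime → q ∣ m → q ≠ 2 → (τ q = 1 ∨ τ q = -1))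
    {a : ℕ} (hma : m ∣ a) (ha4 : a / m % 4 = 3)
    (hJ : ∀ q : ℕ, q.Prime → q ∣ m → q ≠ 2 → jacobiSym (-((a / m : ℕ) : ℤ)) q = τ q) :
    ∃ (j : ℕ) (z : ℤ), (2 : ℚ) ^ j * Literature.NumberTheory.ModularForms.CohenEisenstein.cohenH k a = z := by
  obtain ⟨n₀, f, hsq, h4, hf, rfl, hdiv⟩ := CohenCut.exists_eq_mul_sq_of_cut hma ha4
  rw [hdiv] at hJ
  have hcop : m.Coprime n₀ := coprime_of_cut_sign h4 hτ hJ
  obtain ⟨s, hs1', hs⟩ := Literature.NumberTheory.LFunctions.PrimitiveQuadratic.exists_sign_eq_of_charZero χ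
  have hs1 : s = 1 ∨ s = -1 := by rcases hs1' with ⟨h, -⟩ | ⟨h, -⟩ <;> simp [h]
  refine CohenCut.exists_two_pow_mul_eq_intCast fun ℓ hℓ hdvd =>
    CohenCut.eq_two_of_dvd_den_of_forall_norm_le_one (fun ℓ _ hℓ2 => ?_) hℓ hdvd
  rw [Literature.NumberTheory.ModularForms.CohenEisenstein.cohenH_eq
      (CohenCut.isDiscDecomposition_cut hχ hχq hs hs1 hpar hsq h4 hf hcop), Rat.cast_mul, Rat.cast_intCast, norm_mul]
  exact mul_le_one₀ (CohenCut.norm_lValueDisc_cut_le_one_of_odd_prime hℓ2 hm1 hχ hχq hs hs1 hk hsq h4 hcop)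
    (norm_nonneg _) (Padic.norm_int_le_one _)

end Summit.BirchSwinnertonDyer.BirchSwinnertonDyer.Theorems.PrintCFram.FlipRung

end
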